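import Mathlib
import HarnessLib
import Summits.PneNP.PneNP.Theorems.ClusUniversalCertificateCoordBlkDefs
import Summits.PneNP.PneNP.Theorems.ClusUniversalCertificateCoordBook
import Summits.PneNP.PneNP.Theorems.ClusUniversalCertificateCoordSlice
import Summits.PneNP.PneNP.Theorems.ClusUniversalCertificateCoordInv
import Summits.PneNP.PneNP.Theorems.ClusUniversalCertificateCoordBookBlk
import Summits.PneNP.PneNP.Theorems.ClusUniversalCertificateCoordTransfer

/-!
# Route ClusUniversalCertificate — crux `UniversalCertAll` (stmt-PneNP-19683), path `coord`: the INTEGRAL BLOCK LAYERING reduction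

(cell pnp-ideate, planner p1 g8, rung F-N1; route-independent objects in `…CoordDefs.lean` / `…CoordBlkDefs.lean`, namespace `…Theorems.ClusCoord`.)

This file isolates, BY NAME, the single open statement that the PEEL induction of record (`ucMixDim_all_peel`, file `…CoordBlkDefs.lean`) still
needs once its four bookkeeping hypotheses are the landed theorems `stub_cBook` (p518823), `stub_slice` (p517634), `stub_inv` (p517383) and
`stub_cBookBlk` (p520032):

* `IBL` — INTEGRAL BLOCK LAYERING (the typed form of the cell's "integral transversal partition" conjecture IT, ROUND-8 §3 of
  HOME/pnp-ideate-p1): for every finite `Y ⊆ 𝔽₂^M` with a block structure having a nonempty block (and, as a free extra hypothesis, zero-rare in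
  the sense `GZeroRare`), SOME nonempty block `k` admits a block layer family `L` (a multiset of subsets of `𝔽₂^{M'}`, `M'` = number of coordinates
  outside `k`, covering each fibre of the block deletion with its multiplicity — i.e. a partition of `Y` into SECTIONS over `𝔽₂^{M'}`) with
  `D(Y) ≤ Σ_{S ∈ L} D(S) + (bsize k − 1)|Y| + 2^{bsize k} Z_k(Y)` (`BLayerIneq`).  In words: `Y` splits into sections over the complement of one
  block losing at most `(b − 1)` dimensions per point plus `2^b` per point whose block is zero.
* `IBLAll` — the same for EVERY nonempty block and without the zero-rarity hypothesis (stronger; it is the form the cell's censuses test).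

and proves the reductions `IBL → ∀ M, UCMixDim M` (`ucMixDim_all_of_ibl`: the peel induction with the identity gauge and the block disjunct) and
`IBL → UniversalCertAll` (`universalCertAll_of_ibl`, through the landed `stub_transfer`), plus `IBLAll → IBL`.

EVIDENCE AND LIMITS (numbers, ROUND-7 §6 / ROUND-8 §2–3 of HOME/pnp-ideate-p1; all exact rational LP or exhaustive integer search):
for blocks of size 1 the integral statement was verified for all `Y ⊆ 𝔽₂^3 × 𝔽₂` (152 affine orbits) and for 1.6·10^5 random / structured
`Y ⊆ 𝔽₂^4 × 𝔽₂` (exact search on the hard cases), and it certifies every recorded killer of the earlier menus (cx1, cx2, the ε-split failure, the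
threshold killers); its FRACTIONAL relaxation (the transversal LP `(⊕′)`, which `IBL` implies) was verified exhaustively for all `Y ⊆ 𝔽₂^4` under the
splits 2|2 (191 orbits) and 3|1 (152 orbits) and on > 10^5 random / hill-climbed sets at 3|2, 2|3, 3|3, 4|2 (kit jobs j281560, j282185).  The
natural EXPLICIT sub-rule "the sections may be taken to be the 2^b parallel AFFINE graphs x ↦ Lx + c" is FALSE: `Y = 𝔽₂^4×{0}×{0} ∪
⋃_{p ∈ 𝔽₂^4∖0} (p^⊥ + p)×{1} ⊆ 𝔽₂^8 × 𝔽₂` (136 points) has `D(Y) = 544`, best affine 2-section value `488`, allowance `32` (ROUND-8 §3c; the set is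
itself ONE non-affine section, so `IBL` holds for it trivially).  So any proof of `IBL` must produce genuinely non-affine sections.

HONEST FRAMING: two conjecture DEFINITIONS and sorry-free reductions for an OPEN crux of route ClusUniversalCertificate (FRONTIER rung F-N1);
`IBL` is NOT proved here and nothing in this file bears on P vs NP.
-/

set_option linter.dupNamespace false -- `Summit.PneNP.PneNP.…`: summit = sub-problem name (D-0017 single-conjunct layout)

namespace Summit.PneNP.PneNP.Theorems.ClusCoord

open Finset

/-- **INTEGRAL BLOCK LAYERING** (conjecture; the open statement of the peel induction): a zero-rare set with a nonempty block has SOME nonempty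
block `k` and a block layer family over the complement of `k` satisfying the block layer inequality. -/
def IBL : Prop :=
  ∀ M n : ℕ, ∀ blk : Fin M → Fin n, ∀ Y : Finset (Fin M → ZMod 2), GZeroRare blk Y → (∃ k : Fin n, 0 < bsize blk k) →
    ∃ k : Fin n, 0 < bsize blk k ∧ ∃ M' : ℕ, ∃ h : (univ.filter fun i => blk i ≠ k).card = M',
      ∃ L : List (Finset (Fin M' → ZMod 2)), IsBLayerFamily blk Y k M' h L ∧ BLayerIneq M n blk Y k M' L

/-- **INTEGRAL BLOCK LAYERING, every block** (conjecture, the censused form): EVERY nonempty block of EVERY finite set admits a block layer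
family satisfying the block layer inequality. -/
def IBLAll : Prop :=
  ∀ M n : ℕ, ∀ blk : Fin M → Fin n, ∀ Y : Finset (Fin M → ZMod 2), ∀ k : Fin n, 0 < bsize blk k →
    ∀ M' : ℕ, ∀ h : (univ.filter fun i => blk i ≠ k).card = M',
      ∃ L : List (Finset (Fin M' → ZMod 2)), IsBLayerFamily blk Y k M' h L ∧ BLayerIneq M n blk Y k M' L

/-- the every-block form implies the some-block form. -/
theorem ibl_of_iblAll (hA : IBLAll) : IBL := by
  intro M n blk Y _ hk
  obtain ⟨k, hk⟩ := hk
  obtain ⟨L, hfam, hineq⟩ := hA M n blk Y k hk _ rfl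
  exact ⟨k, hk, _, rfl, L, hfam, hineq⟩

/-- the identity is block-zero preserving. -/
theorem bzp_refl {M n : ℕ} (blk : Fin M → Fin n) : BZP blk (LinearEquiv.refl (ZMod 2) (Fin M → ZMod 2)) := by
  intro y j
  simp

/-- a block structure on `M + 1` coordinates has a nonempty block. -/
theorem exists_bsize_pos {M n : ℕ} (blk : Fin (M + 1) → Fin n) : ∃ k : Fin n, 0 < bsize blk k := by
  refine ⟨blk 0, Finset.card_pos.mpr ⟨0, ?_⟩⟩
  simp

/-- **`IBL` closes the peel induction**: with the four landed bookkeeping stubs, integral block layering gives the mixed certificate in every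
total dimension (identity gauge, block disjunct of `ucMixDim_all_peel`). -/
theorem ucMixDim_all_of_ibl (hI : IBL) : ∀ M : ℕ, UCMixDim M := by
  refine ucMixDim_all_peel stub_cBook stub_slice ?_ stub_inv stub_cBookBlk
  intro M n blk Y hzr
  refine ⟨LinearEquiv.refl (ZMod 2) (Fin (M + 1) → ZMod 2), bzp_refl blk, Or.inr ?_⟩
  have himg : (Y.image fun y => (LinearEquiv.refl (ZMod 2) (Fin (M + 1) → ZMod 2)) y) = Y := by simp
  rw [himg]
  obtain ⟨k, hk, M', h, L, hfam, hineq⟩ := hI (M + 1) n blk Y hzr (exists_bsize_pos blk)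
  exact ⟨k, hk, M', h, L, hfam, hineq⟩

/-- **`IBL` implies the crux** `UniversalCertAll` of route ClusUniversalCertificate (through the landed `stub_transfer`). -/
theorem universalCertAll_of_ibl (hI : IBL) : Summit.PneNP.PneNP.Theses.ClusUniversalCertificate.UniversalCertAll :=
  stub_transfer (ucMixDim_all_of_ibl hI)

/-- the censused every-block form implies the crux. -/
theorem universalCertAll_of_iblAll (hA : IBLAll) : Summit.PneNP.PneNP.Theses.ClusUniversalCertificate.UniversalCertAll :=
  universalCertAll_of_ibl (ibl_of_iblAll hA)

end Summit.PneNP.PneNP.Theorems.ClusCoord
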